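import Summits.BirchSwinnertonDyer.Rank1Residual.F1Sign2.DescentSignAtTwo
import Literature.NumberTheory.EllipticCurves.HeegnerPoints
import HarnessLib

/-!
# Cell `bsd-f1-sign2` — analytic / Waldspurger–Gross–Zagier lens (seat `-an` g5, MEMO-an v1.9–v1.10 §2 AN-13):
# the EGG LEMMA — the two predicates of the «egg bit» and the support statement (PROVED in the companion file
# `EggLemmaAtTwoProofs.lean`)

For `Δ_E > 0` the real locus `E(ℝ) ≅ ℝ/ℤ × ℤ/2` has two components and `2·E(ℝ) = E⁰(ℝ)`. When `rank E(ℚ) = 1` the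
Heegner point `y_K ∈ E(K)` is rational up to torsion, so it carries an ARCHIMEDEAN BIT `b(E,K) = [y_K ∉ E⁰(ℝ)]` («the
Heegner point lies on the egg»). This file fixes the two predicates in which the cell's AN-13 candidates
(`HeegnerPointOnEggAtTwo`, `HeegnerKummerClassNonzeroAtTwo`, `HeegnerEggLawAtTwo`; typer file `HeegnerEggAtTwo.lean`,
filed after their REF1 audit) are stated, and the elementary support statement linking them:

* `EggUpToTorsion W K P` — `P ∈ E(K)` is, up to `K`-rational torsion, a RATIONAL point whose abscissa lies on the egg
  (tree `OnEgg`, `F1Sign2/DescentSignAtTwo.lean`);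
* `NotTwiceUpToTorsion W K P` — `P ∉ 2·E(K) + E(K)_tors` (for the Heegner point: Kolyvagin's first class `c(1) ≠ 0`
  at the prime `2`);
* `EggLemma` — for `Δ > 0`, `E(ℚ)[2] = 0`, `K` imaginary quadratic: `EggUpToTorsion → NotTwiceUpToTorsion`
  (`E(K)[2] = 0` since an irreducible cubic has no root in a quadratic field; odd torsion is 2-divisible in itself;
  `Q′ − σQ′ ∈ E(K)[2] = 0` ⇒ `Q′ ∈ E(ℚ)`; `2E(ℝ) = E⁰(ℝ)`). Census T13.1: `b(E,K) = (I_K mod 2)·[ε = +1]` on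
  4 388/4 388 ENGINE-E rows. REF2-PLACEMENT-v13 §2: folklore, THEOREM-grade. **PROVED** (kernel, 0 sorry) by -an g5
  (`MEMO-an-data/g5/EggDoubling.lean` c390bffaaea95605): typer file `EggLemmaAtTwoProofs.lean`, `theorem eggLemma`.

TYPER FILING (seat `bsd-f1-sign2-ty` g2, D-ty-9/D-ty-10 part 1; CANDIDATES.md row EGG-LEMMA): the three bodies VERBATIM
from `HOME/MEMO-an-data/g5/Sketch_v6.lean` 6879b8d07fb7f041 (-an g5; rc 0). DEFINITIONS / STATEMENT ONLY; nothing
asserted, no named fact (the statement is a support `def`, its proof lands next door). PARTITION: none moved;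
beyond-print theorem: no. bears_on: `stmt-BirchSwinnertonDyer-19099` (line `egg-kolyvagin-two`, stub `S_kolyvaginTwo`).
[cite: Gross1984, §3–5] [cite: SilvermanAEC2009, V.2.3.1 / Ex. 5.11 (real locus)]
-/

noncomputable section

open scoped Classical

namespace Summit.BirchSwinnertonDyer.Rank1Residual.F1Sign2

open Literature.NumberTheory.EllipticCurves Literature.NumberTheory.EllipticCurves.ModularForms

set_option autoImplicit false

section EggBit

/-- `P ∈ E(K)` is, up to `K`-rational torsion, a RATIONAL point whose abscissa lies on the egg
(the non-identity real component): `P = (x, y) + t`, `x y : ℚ`, `OnEgg W x`, `t ∈ E(K)_tors`. A predicate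
(definition with a body). [folklore] -/
def EggUpToTorsion (W : WeierstrassCurve ℚ) (K : Type) [Field K] [NumberField K]
    (P : (W.baseChange K).toAffine.Point) : Prop :=
  ∃ (x y : ℚ) (h : (W.baseChange K).toAffine.Nonsingular (algebraMap ℚ K x) (algebraMap ℚ K y)),
    OnEgg W x ∧
      P - WeierstrassCurve.Affine.Point.some _ _ h ∈ AddCommGroup.torsion (W.baseChange K).toAffine.Point

/-- `P ∉ 2·E(K) + E(K)_tors`: the mod-2 Kummer class of `P` modulo torsion is non-zero
(for the Heegner point: Kolyvagin's first class `c(1) ≠ 0` at the prime `2`). A predicate. [folklore] -/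
def NotTwiceUpToTorsion (W : WeierstrassCurve ℚ) (K : Type) [Field K] [NumberField K]
    (P : (W.baseChange K).toAffine.Point) : Prop :=
  ¬ ∃ Q : (W.baseChange K).toAffine.Point,
      P - 2 • Q ∈ AddCommGroup.torsion (W.baseChange K).toAffine.Point

/-- **EGG LEMMA (support; elementary real geometry of `E(ℝ)`; PROVED as `eggLemma` in `EggLemmaAtTwoProofs.lean`).**
`Δ > 0`, `E(ℚ)[2] = 0`, `K` imaginary quadratic: a point of `E(K)` that is rational-on-the-egg up to torsion is not in
`2E(K) + E(K)_tors`. Proof sketch: `E(K)[2] = 0` (`E(ℚ)[2] = 0` makes the 2-division cubic irreducible, so no quadratic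
field contains a 2-torsion point); hence `t ∈ E(K)_tors` has odd order and is `2t₁` inside `⟨t⟩`, so `R = 2Q + t = 2Q'`
with `Q' ∈ E(K)`; applying complex conjugation `σ` (generator of `Gal(K/ℚ)`), `2(Q' − σQ') = 0`, so `Q' = σQ' ∈ E(ℚ)`;
then `R = 2Q' ∈ 2E(ℝ) = E⁰(ℝ)` (`Δ > 0`: `E(ℝ) ≅ S¹ × ℤ/2`), contradicting `OnEgg`. Only `E(K)[2] = 0` and
`[K : ℚ] = 2` are used by the kernel proof (the hypotheses `0 < W.Δ`, `IsElliptic`, «imaginary» are idle there; kept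
verbatim as audited). [cite: SilvermanAEC2009, V.2.3.1 / Ex. 5.11 (real locus); Gross1984, §5] [folklore] -/
def EggLemma : Prop :=
  ∀ (W : WeierstrassCurve ℚ) [W.IsElliptic], 0 < W.Δ → NoRationalTwoTorsion W →
    ∀ (K : Type) [Field K] [NumberField K], IsImaginaryQuadratic K →
      ∀ P : (W.baseChange K).toAffine.Point, EggUpToTorsion W K P → NotTwiceUpToTorsion W K P

end EggBit

end Summit.BirchSwinnertonDyer.Rank1Residual.F1Sign2

end
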